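import Literature.NumberTheory.LFunctions.ExplicitLogFreeZeroDensityDirichlet
import HarnessLib

/-!
# Explicit local zero counts for Dirichlet `L`-functions near the line `Re s = 1`
# (Thorner–Zaman 2024, §2.3 "Counting zeros": Lemma 2.8, Lemma 2.9, Proposition 2.11,
# Corollary 2.12)

Topic `Literature/NumberTheory/LFunctions` (namespace `Literature.NumberTheory.LFunctions`; the
paper's objects in the existing sub-namespace `ThornerZaman2024` of
`ExplicitLogFreeZeroDensityDirichlet.lean`, whose `zeroCount σ Q = N(σ,Q)` is REUSED, not
re-declared). STATEMENT LAYER (D-0014/D-0064: one file for §2.3 of the source), typed for the cell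
`landau-siegel` (rung F-S3, design family B-dh «explicit Deuring–Heilbronn / log-free zero-density
hybrids», seat ls-Bdh-typer-1): the EXPLICIT "Linnik lemma" — the number of zeros of one primitive
`L(s,χ)` in a disc of radius `r` touching the line `Re s = 1` is at most `r(2 log(qT) − 1) + 4`
(Lemma 2.9), sharpened à la Heath-Brown–Jensen to `≈ (2/3) r log(QT)` on `1/(3 log QT) ≤ r ≤ 1/10`
(Corollary 2.12) — the local zero-density input of every explicit zero-detection / repulsion
argument of the source (its §§4–5), alongside the explicit global count `N(0,Q) ≤ 0.64 Q³ log Q`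
(Lemma 2.8). NAMED FACTS (closed `Prop`s with cites), not proved here, plus the two set inclusions
behind the first two inequalities of Lemma 2.9, which ARE proved.

Source: J. Thorner, A. Zaman, *An explicit version of Bombieri's log-free density estimate and
Sárközy's theorem for shifted primes*, Forum Math. **36** (2024) 1059–1080 = arXiv:2208.11123
[ThornerZaman2024LogFree], §2.3, read on the held copy `paper:arxiv-2208.11123` pp. 6–8
(p0006:L43–L108, p0007:L54–L62, p0008:L1–L52).

## What the source prints (verbatim)

§2.3: "Given `σ ≥ 0`, `T ≥ 0`, `Q ≥ 1`, `1 ≤ q ≤ Q`, and a primitive Dirichlet character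
`χ (mod q)`, we define `N_χ(σ,T) := #{ρ = β + iγ : β ≥ σ, |γ| ≤ T, L(ρ,χ) = 0}` (2.3). It follows
that `N(σ,Q)` in (1.2) can be written as `N(σ,Q) = ∑_{q ≤ Q} ∑_{χ (mod q) primitive} N_χ(σ,Q)` (2.4)."
"**Lemma 2.8.** If `Q ≥ 10⁴`, then `N(0,Q) ≤ 0.64 Q³ log Q`." (Proof: Bennett–Martin–O'Bryant–
Rechnitzer's explicit `N(T,χ)` and Rosser's for `ζ`.) "**Lemma 2.9.** Let `σ ≥ 1`, `0 < r ≤ 1`,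
`q ≥ 1`, `T ≥ 1`, `t ∈ ℝ`, `|t| ≤ T`, and `χ (mod q)` be a primitive Dirichlet character. Define
`n_χ(r, σ + it) := #{ρ = β + iγ : 0 < β < 1, L(ρ,χ) = 0, |σ + it − ρ| ≤ r}` (2.5). The bound
`n_χ(r, σ + it) ≤ n_χ(r, 1 + it) ≤ n_χ(2r, 1 + r + it) ≤ r(2 log(qT) − 1) + 4` holds."
"**Proposition 2.11.** Let `χ (mod q)` be primitive, `T ≥ 1`, `t ∈ ℝ`, `|t| ≤ T`, and
`0 < r < 1/2`. If `χ = 1`, then assume that `3 × 10¹² ≤ |t| ≤ T`. There holds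
`∑_{L(ρ,χ)=0, |1+it−ρ| ≤ r} Re(1/(1 + r + it − ρ)) ≤ (log(qT) + 4.7098)/(4 + 8r)
+ ((4/π) − 1) log(1 + r⁻¹)/(1 + 2r) + 2.6908 + (8r/(1 + 2r)²)(r(2 log(qT) − 1) + 4) + r⁻¹`."
"**Corollary 2.12.** Let `Q ≥ 3`, `T ≥ 1`, and `χ (mod q)` be a primitive Dirichlet character
with `q ≤ Q`. Let `t ∈ ℝ` and `|t| ≤ T`. If `χ = 1`, then assume that `3 × 10¹² ≤ |t| ≤ T`. If
`χ ≠ 1`, then assume that `max{Q,T} > 10 000`. If `n_χ(r,s)` is as in (2.5) and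
`1/(3 log(QT)) ≤ r ≤ 1/10`, then `n_χ(r, 1 + it) ≤ r(1 + 10⁻⁷)⁻¹((2/3) log(QT) + 13.04) + 2`."
(Remark: "our proof can be modified to produce an upper bound of the form
`n_χ(r, 1 + it) ≤ (1/2) r log(QT) + O(log log(QT))` when `1/(3 log(eQT)) ≤ r ≤ 1/30`. But we cannot
take full advantage of this ….") §1, after (1.2): "All sums and counts over `ρ` weigh the
contribution for each `ρ` with its multiplicity."

## Lean rendering / design choices

* `L(s,χ) = DirichletCharacter.LFunction χ s` (Mathlib); "primitive `χ (mod q)`, `q ≥ 1`" is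
  `χ : DirichletCharacter ℂ q`, `[NeZero q]`, `χ.IsPrimitive` — modulus `1` (the character `1`,
  `L = ζ`, Mathlib `LFunction_modOne_eq`) INCLUDED, as in print ("If `χ = 1` …"); for a primitive
  character "`χ = 1`" is the same as "`q = 1`", which is how the two case hypotheses of
  Proposition 2.11 / Corollary 2.12 are written (`q = 1 → 3·10¹² ≤ |t|`, `q ≠ 1 → 10 000 < max Q T`).
* `n_χ(r, s)` is `ThornerZaman2024.localZeroCount χ r s`: the `finsum` of the multiplicity
  `DirichletDisc.zeroOrder χ ρ = analyticOrderNatAt (L(·,χ)) ρ` over the printed set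
  `localZeroSet χ r s = {ρ : 0 < Re ρ < 1, L(ρ,χ) = 0, ‖s − ρ‖ ≤ r}` (counts WITH multiplicity, per
  the source's §1 convention; for `χ ≠ χ₀` the set is finite, `localZeroSet_finite`, so this is a
  genuine count). The sum of Proposition 2.11 is likewise the multiplicity-weighted `finsum` of
  `Re(1/(1 + r + it − ρ))` over `localZeroSet χ r (1 + it)` (every zero of `L(s,χ)` in that disc has
  `0 < Re ρ < 1`: radius `< 1/2`, and `L(s,χ) ≠ 0` on `Re s ≥ 1` away from the pole of `ζ`, which the
  hypothesis `|t| ≥ 3·10¹²` keeps out of the disc).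
* `N(0,Q)` in Lemma 2.8 is the existing `ThornerZaman2024.zeroCount 0 Q` (the (1.2) count
  `β > 0`, `|γ| ≤ Q`, with multiplicity); the source's (2.3)/(2.4) write `β ≥ σ` for the same
  object — for `σ = 0` the strict reading is the weaker (safer) upper-bound statement and is the one
  typed.
* Constants verbatim: `0.64`, `10⁴`, `2 log(qT) − 1`, `4`, `4.7098`, `4/π − 1`, `2.6908`,
  `(1 + 10⁻⁷)⁻¹`, `2/3`, `13.04`, `3 × 10¹²`, `10 000`, `1/(3 log(QT)) ≤ r ≤ 1/10`.

PROVED here (elementary geometry of the discs, no analysis): `localZeroSet_mono_re` — for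
`σ ≥ 1` the disc count at `σ + it` is dominated by the one at `1 + it` as SETS (a zero has
`Re ρ < 1 ≤ σ`); `localZeroSet_subset_double` — the disc `|1 + it − ρ| ≤ r` lies in the disc
`|1 + r + it − ρ| ≤ 2r`; `localZeroSet_subset_lfunctionZeroBox` and `localZeroSet_finite` (`χ ≠ χ₀`).

WHAT THIS IS NOT: nothing analytic is proved here about `n_χ`; no claim about Landau–Siegel zeros.
The tree's inexplicit local counts (Jensen in discs centred at `2 + it`) are PROVED in
`DirichletLogDerivDisc.lean` (`DirichletDisc.exists_sum_zeroOrder_le_of_subset_closedBall`,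
`exists_sum_discZeros_le`); the explicit `N(T,χ)` of Bennett et al. is the named fact
`bmor2021_theorem11` (`DirichletLZeroCountExplicit.lean`); the explicit convexity bound of the
source's Proposition 2.10 is `BGTZ2025.proposition24_thornerZaman`; §2.2 (Lemma 2.4, Corollary 2.5,
Theorem 2.6) is `ExplicitLandauPageFamily.lean`; none is restated. No instance, no notation.

«The programme SEARCHES and TYPES; no claim about Landau–Siegel zeros, Theorems 1–2 of
arXiv:2211.02515 or a repaired Margin232 until a kernel theorem says so.»

## References

* [ThornerZaman2024LogFree] J. Thorner, A. Zaman, Forum Math. 36 (2024), doi:10.1515/forum-2023-0091,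
  arXiv:2208.11123 — Lemma 2.8, Lemma 2.9 (p. 6), Proposition 2.11 (p. 7), Corollary 2.12 (p. 8).
* [BennettMartinOBryantRechnitzer2021] (the explicit `N(T,χ)` behind Lemma 2.8; tree:
  `bmor2021_theorem11`).
* D. R. Heath-Brown, *Zero-free regions for Dirichlet `L`-functions, and the least prime in an
  arithmetic progression*, PLMS 64 (1992) (the Jensen device of Proposition 2.11, as cited there).
-/

noncomputable section

open scoped Classical
open Complex

namespace Literature.NumberTheory.LFunctions

namespace ThornerZaman2024

open DirichletDisc (zeroOrder)

variable {q : ℕ} [NeZero q]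

/-- The zeros of `L(s,χ)` counted by `n_χ(r, s)` of (2.5): `{ρ = β + iγ : 0 < β < 1, L(ρ,χ) = 0,
|s − ρ| ≤ r}` (as a set; multiplicities are carried by `zeroOrder`).
[cite: ThornerZaman2024LogFree, Lemma 2.9 (2.5)] -/
def localZeroSet (χ : DirichletCharacter ℂ q) (r : ℝ) (s : ℂ) : Set ℂ :=
  {ρ | 0 < ρ.re ∧ ρ.re < 1 ∧ χ.LFunction ρ = 0 ∧ ‖s - ρ‖ ≤ r}

/-- Membership in `localZeroSet`. [cite: ThornerZaman2024LogFree, Lemma 2.9 (2.5)] -/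
theorem mem_localZeroSet {χ : DirichletCharacter ℂ q} {r : ℝ} {s ρ : ℂ} :
    ρ ∈ localZeroSet χ r s ↔ 0 < ρ.re ∧ ρ.re < 1 ∧ χ.LFunction ρ = 0 ∧ ‖s - ρ‖ ≤ r :=
  Iff.rfl

/-- **`n_χ(r, s) := #{ρ = β + iγ : 0 < β < 1, L(ρ,χ) = 0, |s − ρ| ≤ r}`** (2.5), counted with
multiplicity ("All sums and counts over `ρ` weigh the contribution for each `ρ` with its
multiplicity", §1): the `finsum` of `zeroOrder χ ρ = analyticOrderNatAt L(·,χ) ρ` over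
`localZeroSet χ r s`. [cite: ThornerZaman2024LogFree, Lemma 2.9 (2.5)] -/
def localZeroCount (χ : DirichletCharacter ℂ q) (r : ℝ) (s : ℂ) : ℕ :=
  ∑ᶠ ρ ∈ localZeroSet χ r s, zeroOrder χ ρ

/-- The multiplicity-weighted sum `∑_{L(ρ,χ)=0, |1+it−ρ| ≤ r} Re(1/(1 + r + it − ρ))` of
Proposition 2.11 (over the zeros of the disc `|1 + it − ρ| ≤ r`, `r < 1/2`, all of which lie in
`0 < Re ρ < 1`). [cite: ThornerZaman2024LogFree, Proposition 2.11] -/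
def localReciprocalSum (χ : DirichletCharacter ℂ q) (r t : ℝ) : ℝ :=
  ∑ᶠ ρ ∈ localZeroSet χ r (1 + t * I), (zeroOrder χ ρ : ℝ) * (1 / (1 + r + t * I - ρ)).re

/-- The right-hand side of Proposition 2.11:
`(log(qT) + 4.7098)/(4 + 8r) + ((4/π) − 1) log(1 + r⁻¹)/(1 + 2r) + 2.6908
+ (8r/(1 + 2r)²)(r(2 log(qT) − 1) + 4) + r⁻¹`. [cite: ThornerZaman2024LogFree, Proposition 2.11] -/
def prop211Bound (q : ℕ) (r T : ℝ) : ℝ :=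
  (Real.log ((q : ℝ) * T) + 4.7098) / (4 + 8 * r) +
    (4 / Real.pi - 1) * Real.log (1 + r⁻¹) / (1 + 2 * r) + 2.6908 +
    8 * r / (1 + 2 * r) ^ 2 * (r * (2 * Real.log ((q : ℝ) * T) - 1) + 4) + r⁻¹

end ThornerZaman2024

open ThornerZaman2024

/-! ### The named facts -/

/-- **Thorner–Zaman 2024, Lemma 2.8 (explicit global zero count; NAMED FACT, as printed).** "If
`Q ≥ 10⁴`, then `N(0,Q) ≤ 0.64 Q³ log Q`", `N(0,Q)` being the (1.2) count of the zeros `β > 0`,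
`|γ| ≤ Q` of all primitive `L(s,χ)` with `q ≤ Q`, with multiplicity (`ThornerZaman2024.zeroCount`).
(From Bennett–Martin–O'Bryant–Rechnitzer's explicit `N(T,χ)` and Rosser.) Not proved here.
[cite: ThornerZaman2024LogFree, Lemma 2.8] -/
def thornerZaman2024_lemma28 : Prop :=
  ∀ Q : ℝ, 10 ^ 4 ≤ Q → (zeroCount 0 Q : ℝ) ≤ 0.64 * Q ^ 3 * Real.log Q

/-- **Thorner–Zaman 2024, Lemma 2.9 (explicit "Linnik lemma": zeros in a disc touching `Re s = 1`;
NAMED FACT, as printed).** "Let `σ ≥ 1`, `0 < r ≤ 1`, `q ≥ 1`, `T ≥ 1`, `t ∈ ℝ`, `|t| ≤ T`, and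
`χ (mod q)` be a primitive Dirichlet character. … The bound
`n_χ(r, σ + it) ≤ n_χ(r, 1 + it) ≤ n_χ(2r, 1 + r + it) ≤ r(2 log(qT) − 1) + 4` holds." All three
inequalities of the chain are recorded (the first two are set inclusions, proved below for the sets;
the third is the analytic content: (2.2), `−ζ′/ζ(1 + r) ≤ 1/r` and Lemma 2.7). Not proved here.
[cite: ThornerZaman2024LogFree, Lemma 2.9] -/
def thornerZaman2024_lemma29 : Prop :=
  ∀ (q : ℕ) [NeZero q] (χ : DirichletCharacter ℂ q), χ.IsPrimitive →
    ∀ σ r T t : ℝ, 1 ≤ σ → 0 < r → r ≤ 1 → 1 ≤ T → |t| ≤ T →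
      localZeroCount χ r (σ + t * I) ≤ localZeroCount χ r (1 + t * I) ∧
        localZeroCount χ r (1 + t * I) ≤ localZeroCount χ (2 * r) (1 + r + t * I) ∧
          (localZeroCount χ (2 * r) (1 + r + t * I) : ℝ) ≤
            r * (2 * Real.log ((q : ℝ) * T) - 1) + 4

/-- **Thorner–Zaman 2024, Proposition 2.11 (Heath-Brown–Jensen bound for the local sum over
zeros; NAMED FACT, as printed).** "Let `χ (mod q)` be primitive, `T ≥ 1`, `t ∈ ℝ`, `|t| ≤ T`, and
`0 < r < 1/2`. If `χ = 1`, then assume that `3 × 10¹² ≤ |t| ≤ T`. There holds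
`∑_{L(ρ,χ)=0, |1+it−ρ| ≤ r} Re(1/(1 + r + it − ρ)) ≤ (log(qT) + 4.7098)/(4 + 8r)
+ ((4/π) − 1) log(1 + r⁻¹)/(1 + 2r) + 2.6908 + (8r/(1 + 2r)²)(r(2 log(qT) − 1) + 4) + r⁻¹`."
("`χ = 1`" = the character of modulus `1`, `L = ζ`: for a primitive character this is `q = 1`.)
Not proved here. [cite: ThornerZaman2024LogFree, Proposition 2.11] -/
def thornerZaman2024_proposition211 : Prop :=
  ∀ (q : ℕ) [NeZero q] (χ : DirichletCharacter ℂ q), χ.IsPrimitive →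
    ∀ r T t : ℝ, 0 < r → r < 1 / 2 → 1 ≤ T → |t| ≤ T → (q = 1 → 3 * 10 ^ 12 ≤ |t|) →
      localReciprocalSum χ r t ≤ prop211Bound q r T

/-- **Thorner–Zaman 2024, Corollary 2.12 (the sharpened explicit local zero count; NAMED FACT, as
printed).** "Let `Q ≥ 3`, `T ≥ 1`, and `χ (mod q)` be a primitive Dirichlet character with `q ≤ Q`.
Let `t ∈ ℝ` and `|t| ≤ T`. If `χ = 1`, then assume that `3 × 10¹² ≤ |t| ≤ T`. If `χ ≠ 1`, then
assume that `max{Q,T} > 10 000`. If `n_χ(r,s)` is as in (2.5) and `1/(3 log(QT)) ≤ r ≤ 1/10`, then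
`n_χ(r, 1 + it) ≤ r(1 + 10⁻⁷)⁻¹((2/3) log(QT) + 13.04) + 2`." Not proved here.
[cite: ThornerZaman2024LogFree, Corollary 2.12] -/
def thornerZaman2024_corollary212 : Prop :=
  ∀ Q T : ℝ, 3 ≤ Q → 1 ≤ T →
    ∀ (q : ℕ) [NeZero q] (χ : DirichletCharacter ℂ q), (q : ℝ) ≤ Q → χ.IsPrimitive →
      ∀ t : ℝ, |t| ≤ T → (q = 1 → 3 * 10 ^ 12 ≤ |t|) → (q ≠ 1 → 10000 < max Q T) →
        ∀ r : ℝ, 1 / (3 * Real.log (Q * T)) ≤ r → r ≤ 1 / 10 →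
          (localZeroCount χ r (1 + t * I) : ℝ) ≤
            r * (1 + 1 / 10 ^ 7)⁻¹ * (2 / 3 * Real.log (Q * T) + 13.04) + 2

/-! ### Bookkeeping (proved): the geometry behind the first two inequalities of Lemma 2.9 -/

namespace ThornerZaman2024

variable {q : ℕ} [NeZero q]

/-- **First inequality of Lemma 2.9, as sets:** for `σ ≥ 1` the zeros of the disc `|σ + it − ρ| ≤ r`
lie in the disc `|1 + it − ρ| ≤ r` ("it follows from the geometry of complex numbers": a zero has
`Re ρ < 1 ≤ σ`, so moving the centre from `σ + it` to `1 + it` does not increase the distance).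
[cite: ThornerZaman2024LogFree, Lemma 2.9 (proof)] -/
theorem localZeroSet_mono_re (χ : DirichletCharacter ℂ q) (r : ℝ) {σ : ℝ} (hσ : 1 ≤ σ) (t : ℝ) :
    localZeroSet χ r (σ + t * I) ⊆ localZeroSet χ r (1 + t * I) := by
  rintro ρ ⟨h0, h1, hz, hd⟩
  refine ⟨h0, h1, hz, le_trans ?_ hd⟩
  -- compare the two distances through their squares
  have hre1 : ((1 : ℂ) + t * I - ρ).re = 1 - ρ.re := by simp
  have him1 : ((1 : ℂ) + t * I - ρ).im = t - ρ.im := by simp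
  have hreσ : ((σ : ℂ) + t * I - ρ).re = σ - ρ.re := by simp
  have himσ : ((σ : ℂ) + t * I - ρ).im = t - ρ.im := by simp
  have hsq : ‖(1 : ℂ) + t * I - ρ‖ ^ 2 ≤ ‖(σ : ℂ) + t * I - ρ‖ ^ 2 := by
    rw [Complex.sq_norm, Complex.sq_norm, Complex.normSq_apply, Complex.normSq_apply, hre1, him1,
      hreσ, himσ]
    nlinarith
  exact (pow_le_pow_iff_left₀ (norm_nonneg _) (norm_nonneg _) two_ne_zero).1 hsq

/-- **Second inequality of Lemma 2.9, as sets:** for `r ≥ 0` the disc `|1 + it − ρ| ≤ r` lies in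
the disc `|1 + r + it − ρ| ≤ 2r` (triangle inequality).
[cite: ThornerZaman2024LogFree, Lemma 2.9 (proof)] -/
theorem localZeroSet_subset_double (χ : DirichletCharacter ℂ q) {r : ℝ} (hr : 0 ≤ r) (t : ℝ) :
    localZeroSet χ r (1 + t * I) ⊆ localZeroSet χ (2 * r) (1 + r + t * I) := by
  rintro ρ ⟨h0, h1, hz, hd⟩
  refine ⟨h0, h1, hz, ?_⟩
  have hsplit : (1 : ℂ) + r + t * I - ρ = ((1 : ℂ) + t * I - ρ) + (r : ℂ) := by ring
  calc ‖(1 : ℂ) + r + t * I - ρ‖ = ‖((1 : ℂ) + t * I - ρ) + (r : ℂ)‖ := by rw [hsplit]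
    _ ≤ ‖(1 : ℂ) + t * I - ρ‖ + ‖(r : ℂ)‖ := norm_add_le _ _
    _ ≤ r + r := by
        refine add_le_add hd ?_
        rw [Complex.norm_real, Real.norm_eq_abs, abs_of_nonneg hr]
    _ = 2 * r := by ring

/-- The disc zero set lies in the tree's box of non-trivial zeros up to height `|Im s| + r`
(`lfunctionZeroBox χ H = {ρ : L(ρ,χ) = 0, 0 < Re ρ < 1, |Im ρ| ≤ H}`): `|Im ρ| ≤ |Im s| + |s − ρ|`.
[cite: ThornerZaman2024LogFree, Lemma 2.9 (2.5)] -/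
theorem localZeroSet_subset_lfunctionZeroBox (χ : DirichletCharacter ℂ q) (r : ℝ) (s : ℂ) :
    localZeroSet χ r s ⊆ lfunctionZeroBox χ (|s.im| + r) := by
  rintro ρ ⟨h0, h1, hz, hd⟩
  refine ⟨hz, h0, h1, ?_⟩
  have him : |(s - ρ).im| ≤ ‖s - ρ‖ := Complex.abs_im_le_norm _
  have him' : (s - ρ).im = s.im - ρ.im := by simp
  rw [him'] at him
  have htri : |ρ.im| - |s.im| ≤ |s.im - ρ.im| := by
    rw [abs_sub_comm]
    exact abs_sub_abs_le_abs_sub ρ.im s.im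
  linarith

/-- For `χ ≠ χ₀` the disc zero set is finite, so `n_χ(r, s)` is a genuine (multiplicity-weighted)
count. [cite: ThornerZaman2024LogFree, Lemma 2.9 (2.5)] -/
theorem localZeroSet_finite {χ : DirichletCharacter ℂ q} (hχ : χ ≠ 1) (r : ℝ) (s : ℂ) :
    (localZeroSet χ r s).Finite :=
  (lfunctionZeroBox_finite hχ _).subset (localZeroSet_subset_lfunctionZeroBox χ r s)

end ThornerZaman2024

end Literature.NumberTheory.LFunctions

end
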